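/-
Origin: expansion seat `planner-pub-hodgecm-pv06-g3-0`, handover #11b 2026-08-18T07:53:10Z (`HOME/pub-hodgecm-pv06-g3/lean/Pv06g3/TorusUnitaryEmbedding.lean`, md5 106fd3d4, 146 lines);
landed by the gen-7 packager in gate run 26 as `HodgeCM/PerL34/TorusUnitaryEmbedding.lean` (import ^import Prl1g4\.→import HodgeCM.Automorphic. ×1; import ^import Pv[0-9]+g[0-9]+\.→import HodgeCM.PerL34. ×2).
-/
/-
Copyright: pub-hodgecm cell, unit pub-hodgecm-pv06-g3 (DAG-node prover #06, gen 3). Lands as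
`HodgeCM/PerL34/TorusUnitaryEmbedding.lean` with the import rewrites
`Prl1g4.AdelicUnitaryGroup` ↦ `HodgeCM.Automorphic.AdelicUnitaryGroup` (prl1-g4 #5a),
`Pv11g5.SeesawTorus` ↦ `HodgeCM.PerL34.SeesawTorus` (pv11-g5 #1),
`Pv06g3.DiagonalTorusGL` ↦ `HodgeCM.PerL34.DiagonalTorusGL` (pv06-g3 #11a).
-/
import Summits.HodgeConjecture.HodgeCM.Automorphic.AdelicUnitaryGroup
import Summits.HodgeConjecture.HodgeCM.PerL34.SeesawTorus_3
import Summits.HodgeConjecture.HodgeCM.PerL34.DiagonalTorusGL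

/-!
# The torus embedding `T = U(W₁) × U(W₂) ⊂ U(W)` on adelic points (field `jT` of `CompactTorusModelData`)

PerL v5 §3.2 (l. 305 "`W = W₁ ⊥ W₂`", l. 315 "`T := U(W₁) × U(W₂) ≅ U(1)²`, a maximal torus of `U(W)`") and
Prop. 3.6 Step 2 (ll. 423–432).  In a basis of `W` adapted to the orthogonal splitting the hermitian matrix of `W`
is DIAGONAL, `H = diagonal h`, and `T` is the diagonal torus of `U(W) = U(H) ≤ GL₂`.  This file realises the
embedding on ADELIC points for the cell's genuine objects:

* the torus `T(𝔸) = SeesawTorus L⁺ L = U(1)(𝔸_{L⁺}) × U(1)(𝔸_{L⁺})` of pv11-g5 (`U(1)(𝔸_{L⁺}) = relNormOneIdeles L⁺ L`,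
  pv11-g4: the ideles `u ∈ 𝔸_L^×` with `u ū = 1`, `mem_relNormOneIdeles_iff_mul_conj`);
* the adelic unitary group `U(H)(𝔸_{L⁺}) = HodgeCM.Adelic.adelicUnitaryGroup L H ≤ GL₂(𝔸_L)` of prl1-g4
  (`{g | (ḡ)ᵀ H g = H}`, conjugation `adeleConj L = c ⊗ id`), with rational points `adelicUnitaryRat L H`
  (the image of `U(H)(L⁺) ≤ GL₂(L)` under `toAdeleGL`).

Results (KERNEL; nothing cited, nothing posited):
* `toGL L : SeesawTorus L⁺ L →* GL (Fin 2) 𝔸_L`, `(u₁, u₂) ↦ diag(u₁, u₂)` (`val_toGL`), continuous (`continuous_toGL`);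
* `toGL_mem : toGL L t ∈ adelicUnitaryGroup L (diagonal h)` for EVERY diagonal form `h : Fin 2 → L` — norm-one ideles are
  unitary (`DiagonalTorus.diagGL₂_unitary_of_mul_conj_eq_one` + `val_mul_adeleConj_eq_one`);
* **`jT L h : SeesawTorus L⁺ L →* ↥(adelicUnitaryGroup L (diagonal h))`** (`coe_jT`, `continuous_jT`) — the field `jT`
  (with `jT_cont`) of pv06-g3's `CompactTorusModelData` for PerL's genuine torus and core group;
* **`rat_le_comap_jT : SeesawTorus.rat L⁺ L ≤ (adelicUnitaryRat L (diagonal h)).comap (jT L h)`** — the field `jT_Λ`: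
  a pair of principal norm-one ideles `((ℓ₁)_𝔸, (ℓ₂)_𝔸)` is `toAdeleGL (diag(ℓ₁, ℓ₂))` (`DiagonalTorus.map_diagGL₂`) with
  `diag(ℓ₁, ℓ₂) ∈ U(H)(L⁺)` because `ℓᵢ ℓ̄ᵢ = 1` already in `L` (`adeleConj_algebraMap` and injectivity of `L → 𝔸_L`).

Not done here: a non-diagonal Gram matrix (conjugate by the diagonalising basis change), the archimedean block
and the weight (pv11-g5 `SeesawArchTorus`, `archWeight`), the finite-adelic factor `Gf` / `comm`, `unfold`, `dense`.
-/

set_option autoImplicit false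

noncomputable section

open Matrix NumberField
open HodgeCM.PerL34.DiagonalTorus HodgeCM.Adelic
open Literature.AlgebraicGeometry.ShimuraVarieties (unitaryGroup conjRingHomK)

namespace HodgeCM.PerL34.TorusEmbedding

variable (L : Type) [Field L] [NumberField L] [IsCMField L]

local notation "𝔸" => AdeleRing (𝓞 L) L
local notation3 "L⁺" => maximalRealSubfield L

/-- The norm-one relation `u · ū = 1` of a torus idele, in the adele ring. -/
theorem val_mul_adeleConj_eq_one (u : relNormOneIdeles L⁺ L) :
    ((u : ideleGroup L) : 𝔸) * adeleConj L ((u : ideleGroup L) : 𝔸) = 1 := by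
  have h := (mem_relNormOneIdeles_iff_mul_conj (L := L) (u : ideleGroup L)).1 u.2
  have h' := congrArg (fun x : ideleGroup L => (x : 𝔸)) h
  simpa only [Units.val_mul, Literature.NumberTheory.Automorphic.AdeleRing.coe_smul_units, Units.val_one,
    adeleConj_apply] using h'

omit [IsCMField L] in
/-- **`T(𝔸) → GL₂(𝔸_L)`**, `(u₁, u₂) ↦ diag(u₁, u₂)`. -/
def toGL : SeesawTorus L⁺ L →* GL (Fin 2) 𝔸 :=
  diagGL₂.comp
    ((((relNormOneIdeles L⁺ L).subtype.comp (SeesawTorus.fst L⁺ L)).prod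
      ((relNormOneIdeles L⁺ L).subtype.comp (SeesawTorus.snd L⁺ L))))

omit [IsCMField L] in
/-- (Ported verbatim from the HodgeCMPerL package; no docstring in the source.) -/
theorem toGL_apply (t : SeesawTorus L⁺ L) :
    toGL L t = diagGL₂ (((SeesawTorus.fst L⁺ L t : relNormOneIdeles L⁺ L) : ideleGroup L),
      ((SeesawTorus.snd L⁺ L t : relNormOneIdeles L⁺ L) : ideleGroup L)) := rfl

omit [IsCMField L] in
/-- (Ported verbatim from the HodgeCMPerL package; no docstring in the source.) -/
theorem val_toGL (t : SeesawTorus L⁺ L) :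
    ((toGL L t : GL (Fin 2) 𝔸) : Matrix (Fin 2) (Fin 2) 𝔸) =
      diagonal ![(((SeesawTorus.fst L⁺ L t : relNormOneIdeles L⁺ L) : ideleGroup L) : 𝔸),
        (((SeesawTorus.snd L⁺ L t : relNormOneIdeles L⁺ L) : ideleGroup L) : 𝔸)] := by
  rw [toGL_apply, val_diagGL₂]

omit [IsCMField L] in
/-- (Ported verbatim from the HodgeCMPerL package; no docstring in the source.) -/
theorem continuous_toGL : Continuous (toGL L) :=
  continuous_diagGL₂.comp
    ((continuous_subtype_val.comp (SeesawTorus.continuous_fst L⁺ L)).prodMk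
      (continuous_subtype_val.comp (SeesawTorus.continuous_snd L⁺ L)))

/-- **Norm-one pairs are unitary for every diagonal form**: `diag(u₁, u₂) ∈ U(diagonal h)(𝔸_{L⁺})`. -/
theorem toGL_mem (h : Fin 2 → L) (t : SeesawTorus L⁺ L) : toGL L t ∈ adelicUnitaryGroup L (diagonal h) := by
  rw [mem_adelicUnitaryGroup_iff, diagonal_map (map_zero _), toGL_apply]
  exact diagGL₂_unitary_of_mul_conj_eq_one (adeleConj L) _ _ (val_mul_adeleConj_eq_one L _)
    (val_mul_adeleConj_eq_one L _)

/-- **The torus embedding `jT : T(𝔸) →* U(W)(𝔸)`** for the diagonal Gram matrix `H = diagonal h` (field `jT` of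
`CompactTorusModelData`, PerL v5 l. 315). -/
def jT (h : Fin 2 → L) : SeesawTorus L⁺ L →* ↥(adelicUnitaryGroup L (diagonal h)) :=
  (toGL L).codRestrict _ (toGL_mem L h)

/-- (Ported verbatim from the HodgeCMPerL package; no docstring in the source.) -/
@[simp]
theorem coe_jT (h : Fin 2 → L) (t : SeesawTorus L⁺ L) :
    ((jT L h t : adelicUnitaryGroup L (diagonal h)) : GL (Fin 2) 𝔸) = toGL L t := rfl

/-- Field `jT_cont`. -/
theorem continuous_jT (h : Fin 2 → L) : Continuous (jT L h) :=
  (continuous_toGL L).subtype_mk _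

/-- (Ported verbatim from the HodgeCMPerL package; no docstring in the source.) -/
theorem jT_injective (h : Fin 2 → L) : Function.Injective (jT L h) := by
  intro s t hst
  have h1 := congrArg (fun g : adelicUnitaryGroup L (diagonal h) => (g : GL (Fin 2) 𝔸)) hst
  simp only [coe_jT, toGL_apply] at h1
  obtain ⟨e₁, e₂⟩ := Prod.mk.inj (diagGL₂_injective h1)
  exact SeesawTorus.ext (Subtype.ext e₁) (Subtype.ext e₂)

/-- **Field `jT_Λ`: rational points go to rational points**, `T(L⁺) = L¹ × L¹ ↦ U(H)(L⁺)`. -/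
theorem rat_le_comap_jT (h : Fin 2 → L) :
    SeesawTorus.rat L⁺ L ≤ (adelicUnitaryRat L (diagonal h)).comap (jT L h) := by
  intro t ht
  rw [Subgroup.mem_comap, mem_adelicUnitaryRat_iff]
  obtain ⟨ht₁, ht₂⟩ := (SeesawTorus.mem_rat_iff t).1 ht
  obtain ⟨ℓ₁, hℓ₁⟩ := MonoidHom.mem_range.1 ((mem_relNormOneRat_iff (K := L⁺) (L := L) _).1 ht₁)
  obtain ⟨ℓ₂, hℓ₂⟩ := MonoidHom.mem_range.1 ((mem_relNormOneRat_iff (K := L⁺) (L := L) _).1 ht₂)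
  have e₁ := val_mul_adeleConj_eq_one L (SeesawTorus.fst L⁺ L t)
  have e₂ := val_mul_adeleConj_eq_one L (SeesawTorus.snd L⁺ L t)
  rw [← hℓ₁, Units.coe_map, MonoidHom.coe_coe] at e₁
  rw [← hℓ₂, Units.coe_map, MonoidHom.coe_coe] at e₂
  refine ⟨diagGL₂ (ℓ₁, ℓ₂), ?_, ?_⟩
  · -- `diag(ℓ₁, ℓ₂) ∈ U(H)(L⁺)`: `ℓᵢ ℓ̄ᵢ = 1` holds in `L` since it holds in `𝔸_L`
    rw [Literature.AlgebraicGeometry.ShimuraVarieties.mem_unitaryGroup_iff]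
    refine diagGL₂_unitary_of_mul_conj_eq_one (conjRingHomK L) h (ℓ₁, ℓ₂) ?_ ?_
    · apply (algebraMap L 𝔸).injective
      rw [map_mul, map_one, ← adeleConj_algebraMap]
      exact e₁
    · apply (algebraMap L 𝔸).injective
      rw [map_mul, map_one, ← adeleConj_algebraMap]
      exact e₂
  · -- `toAdeleGL (diag(ℓ₁, ℓ₂)) = diag((ℓ₁)_𝔸, (ℓ₂)_𝔸) = jT t`
    have hm : toAdeleGL L (diagGL₂ (ℓ₁, ℓ₂)) =
        diagGL₂ (Units.map (algebraMap L 𝔸 : L →* 𝔸) ℓ₁, Units.map (algebraMap L 𝔸 : L →* 𝔸) ℓ₂) :=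
      map_diagGL₂ (algebraMap L 𝔸) (ℓ₁, ℓ₂)
    rw [hm, hℓ₁, hℓ₂, coe_jT, toGL_apply]

/-- Torus elements commute with each other inside `U(W)(𝔸)` (abelian image). -/
theorem jT_comm (h : Fin 2 → L) (s t : SeesawTorus L⁺ L) : jT L h s * jT L h t = jT L h t * jT L h s := by
  rw [← map_mul, ← map_mul, mul_comm]

end HodgeCM.PerL34.TorusEmbedding
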